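import Literature.Combinatorics.Optimization.EquivariantPsdFactorization
import Literature.Computation.Certificates.SemidefiniteComplementarity
import HarnessLib

/-!
# Structure theorem for equivariant psd factorizations (Fawzi–Saunderson–Parrilo), matching polytope

Fawzi–Saunderson–Parrilo, *Equivariant semidefinite lifts and sum-of-squares hierarchies*
(arXiv:1312.6662, SIAM J. Optim. 25 (2015)), **Theorem 1** [cite: FawziSaundersonParrilo2013, Thm. 1 (p. 7)]:
"Let `P` be a `G`-orbitope. Assume `P` has a `G`-equivariant psd lift of size `d`. Then there exists a
`G`-invariant subspace `V` of `F(X, ℝ)` such that: (i) for any linear form `ℓ` on `ℝⁿ`, `ℓ_max − ℓ` is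
`V`-sos on `X`; (ii) `dim V ≤ d³`."  Their **Remark 3** [cite: FawziSaundersonParrilo2013, Remark 3 (p. 12)]:
the argument only uses the FACTORIZATION-LEVEL data — a map `A : X → S^d_+` with
`A(g·x) = ρ(g) A(x) ρ(g)ᵀ` and `p(x) = ⟨A(x), B⟩` with `B ⪰ 0` — and **Theorem 4** [cite: FawziSaundersonParrilo2013, Thm. 4 (p. 10)]:
"the representation `ρ : G → GL(ℝ^d)` can be taken to be orthogonal".

This file PROVES the factorization-level structure theorem for the symmetric group `S_n` acting on the
perfect matchings of `K_n` and the odd-cut slacks of Edmonds' perfect matching polytope, in the tree's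
vocabulary `Literature.Combinatorics.Optimization.IsEquivariantPsdFactorization` (only `A`-side
equivariance, `ρ : S_n → GL_d(ℝ)` arbitrary):

* `IsEquivariantPsdFactorization.exists_invariant_sos_subspace`: an `S_n`-equivariant psd factorization of
  size `d` of the odd-cut slack matrix yields an `S_n`-invariant subspace `V` of real functions on perfect
  matchings with `dim V ≤ d²` such that every odd-cut slack `|δ(U) ∩ M| − 1` is a finite sum of squares of
  elements of `V`.

Proof (FSP §3.2–3.3 with one change): orthogonalise `ρ` by Weyl averaging (`Q = Σ_σ ρ(σ)ᵀρ(σ)`,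
`R = Q^{1/2}`, `ρ' = R ρ R⁻¹ ∈ O(d)`, `A' = R A R`, `B' = R⁻¹ B R⁻¹`) [cite: FawziSaundersonParrilo2013, Thm. 4 (p. 10)];
take `V` = the span of the `d²` ENTRY FUNCTIONS of the psd square root `C(M) = A'(M)^{1/2}`, which is
`ρ'`-equivariant by uniqueness of psd square roots, so `V` is invariant; and with `B'(U) = Lᵀ L`,
`⟨A'(M), B'(U)⟩ = ‖L C(M)‖_F²` is a sum of `d²` squares of elements of `V`. DIMENSION NOTE: the printed
Theorem 1 states `d³` for general orbitopes and `d²` for regular ones (Theorem 5, `V` = span of the entries of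
`ρ|_N`); routing their Theorem-1 argument through `A(x)^{1/2}` instead of the eigenprojections `P_{W_i}` of
`A(x_0)` gives `d²` in general, which is the form proved here (the perfect-matching orbitope is not regular).

NOT here: lifts themselves (the passage lift ↔ factorization, FSP Thm. 4 / GPT13 Thm. 2.4); the degree
analysis of invariant subspaces (FSP §4–5); anything on non-equivariant psd rank.
-/

noncomputable section

open Matrix Finset
open scoped MatrixOrder

namespace Literature.Combinatorics.Optimization

open Literature.Barriers.PneNP
open Literature.Computation.Certificates.SemidefiniteComplementarity

/-! ### Weyl's unitarian trick for a finite group, in matrix form -/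

section Unitarize

variable {G : Type*} [Group G] [Fintype G] {d : ℕ}

/-- **Orthogonalisation of a real representation of a finite group** (Weyl averaging): for
`ρ : G → GL_d(ℝ)` there is a positive definite (symmetric, invertible) `R` with `R ρ(g) R⁻¹` orthogonal for
all `g` (`R = Q^{1/2}`, `Q = Σ_g ρ(g)ᵀ ρ(g)`). [cite: FawziSaundersonParrilo2013, Thm. 4 (p. 10)] -/
theorem exists_posDef_orthogonalizer (ρ : G →* GL (Fin d) ℝ) :
    ∃ R : Matrix (Fin d) (Fin d) ℝ, R.PosDef ∧
      ∀ g, (R * (ρ g : Matrix (Fin d) (Fin d) ℝ) * R⁻¹)ᵀ * (R * (ρ g : Matrix (Fin d) (Fin d) ℝ) * R⁻¹) = 1 := by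
  classical
  set Q : Matrix (Fin d) (Fin d) ℝ :=
    ∑ g, (ρ g : Matrix (Fin d) (Fin d) ℝ)ᵀ * (ρ g : Matrix (Fin d) (Fin d) ℝ) with hQ
  -- `Q = 1 + Σ_{g ≠ 1} ρ(g)ᵀ ρ(g)` is positive definite
  have hterm : ∀ g, ((ρ g : Matrix (Fin d) (Fin d) ℝ)ᵀ * (ρ g : Matrix (Fin d) (Fin d) ℝ)).PosSemidef :=
    fun g => by
      simpa only [conjTranspose_eq_transpose_of_trivial] using
        posSemidef_conjTranspose_mul_self (ρ g : Matrix (Fin d) (Fin d) ℝ)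
  have hQpd : Q.PosDef := by
    have hsplit : Q = 1 + ∑ g ∈ univ.erase 1,
        (ρ g : Matrix (Fin d) (Fin d) ℝ)ᵀ * (ρ g : Matrix (Fin d) (Fin d) ℝ) := by
      rw [hQ, ← add_sum_erase _ _ (mem_univ (1 : G)), map_one, Units.val_one, transpose_one,
        Matrix.one_mul]
    rw [hsplit]
    exact PosDef.one.add_posSemidef (posSemidef_sum _ fun g _ => hterm g)
  -- invariance `ρ(h)ᵀ Q ρ(h) = Q`
  have hQinv : ∀ h : G,
      (ρ h : Matrix (Fin d) (Fin d) ℝ)ᵀ * Q * (ρ h : Matrix (Fin d) (Fin d) ℝ) = Q := by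
    intro h
    rw [hQ, mul_sum, sum_mul]
    calc ∑ g, (ρ h : Matrix (Fin d) (Fin d) ℝ)ᵀ *
            ((ρ g : Matrix (Fin d) (Fin d) ℝ)ᵀ * (ρ g : Matrix (Fin d) (Fin d) ℝ)) *
            (ρ h : Matrix (Fin d) (Fin d) ℝ)
        = ∑ g, (ρ (g * h) : Matrix (Fin d) (Fin d) ℝ)ᵀ * (ρ (g * h) : Matrix (Fin d) (Fin d) ℝ) := by
          refine sum_congr rfl fun g _ => ?_
          rw [map_mul, Units.val_mul, transpose_mul]
          simp only [Matrix.mul_assoc]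
      _ = ∑ g, (ρ g : Matrix (Fin d) (Fin d) ℝ)ᵀ * (ρ g : Matrix (Fin d) (Fin d) ℝ) :=
          Fintype.sum_equiv (Equiv.mulRight h) _ _ fun g => rfl
  -- `R = Q^{1/2}`
  set R : Matrix (Fin d) (Fin d) ℝ := CFC.sqrt Q with hR
  have hRpsd : R.PosSemidef := (CFC.sqrt_nonneg Q).posSemidef
  have hRR : R * R = Q := CFC.sqrt_mul_sqrt_self Q hQpd.posSemidef.nonneg
  have hRsymm : Rᵀ = R := by
    have h := hRpsd.1.eq
    rwa [conjTranspose_eq_transpose_of_trivial] at h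
  have hRdet : IsUnit R.det := by
    have hQdet : Q.det ≠ 0 := hQpd.det_pos.ne'
    rw [← hRR, det_mul] at hQdet
    exact isUnit_iff_ne_zero.2 fun h0 => hQdet (by rw [h0, mul_zero])
  have hRpd : R.PosDef := (hRpsd.posDef_iff_det_ne_zero).2 hRdet.ne_zero
  refine ⟨R, hRpd, fun g => ?_⟩
  rw [transpose_mul, transpose_mul, transpose_nonsing_inv, hRsymm]
  -- `R⁻¹ ρᵀ R R ρ R⁻¹ = R⁻¹ (ρᵀ Q ρ) R⁻¹ = R⁻¹ Q R⁻¹ = 1`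
  calc R⁻¹ * ((ρ g : Matrix (Fin d) (Fin d) ℝ)ᵀ * R) * (R * (ρ g : Matrix (Fin d) (Fin d) ℝ) * R⁻¹)
      = R⁻¹ * ((ρ g : Matrix (Fin d) (Fin d) ℝ)ᵀ * (R * R) * (ρ g : Matrix (Fin d) (Fin d) ℝ)) * R⁻¹ := by
        simp only [Matrix.mul_assoc]
    _ = R⁻¹ * (R * R) * R⁻¹ := by rw [hRR, hQinv]
    _ = 1 := by
        rw [← Matrix.mul_assoc R⁻¹ R R, nonsing_inv_mul R hRdet, Matrix.one_mul, mul_nonsing_inv R hRdet]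

end Unitarize

/-! ### The structure theorem for `S_n`-equivariant psd factorizations of the matching slack matrix -/

section Structure

variable {n d : ℕ}

/-- For a real matrix `X`, `tr(X Xᵀ) = Σ_{a,b} X_{ab}²`. [folklore] -/
private theorem trace_mul_transpose_self_eq_sum_sq (X : Matrix (Fin d) (Fin d) ℝ) :
    (X * Xᵀ).trace = ∑ a, ∑ b, X a b ^ 2 := by
  simp [trace, mul_apply, sq]

/-- Entry formula `(P C Pᵀ)_{kl} = Σ_a Σ_b P_{ka} P_{lb} C_{ab}`. [folklore] -/
private theorem conj_apply (P C : Matrix (Fin d) (Fin d) ℝ) (k l : Fin d) :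
    (P * C * Pᵀ) k l = ∑ a, ∑ b, P k a * P l b * C a b := by
  simp only [mul_apply, transpose_apply, sum_mul]
  rw [sum_comm]
  exact sum_congr rfl fun a _ => sum_congr rfl fun b _ => by ring

/-- **Structure theorem for equivariant psd factorizations of the perfect-matching slack matrix**
(Fawzi–Saunderson–Parrilo Theorem 1 / Remark 3 at factorization level, square-root form): an
`S_n`-equivariant psd factorization `(ρ, A, B)` of size `d` of the odd-cut slack matrix of `P_PM(K_n)`
(`A(σ·M) = ρ(σ) A(M) ρ(σ)ᵀ`, `ρ : S_n → GL_d(ℝ)` arbitrary, `B` unconstrained) yields an `S_n`-invariant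
subspace `V` of real functions on the perfect matchings with `dim V ≤ d²` such that every odd-cut slack
`M ↦ |δ(U) ∩ M| − 1` (`U` odd) is a finite sum of squares of elements of `V`. The printed Theorem 1 has `d³`
(general orbitopes; `d²` for regular orbitopes, Theorem 5); the square-root variant of its proof used here
gives `d²`. [cite: FawziSaundersonParrilo2013, Thm. 1 (p. 7), Remark 3 (p. 12), Thm. 4 (p. 10)] -/
theorem IsEquivariantPsdFactorization.exists_invariant_sos_subspace
    {ρ : Equiv.Perm (Fin n) →* GL (Fin d) ℝ} {A : Finset (Sym2 (Fin n)) → Matrix (Fin d) (Fin d) ℝ}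
    {B : Finset (Fin n) → Matrix (Fin d) (Fin d) ℝ} (h : IsEquivariantPsdFactorization n d ρ A B) :
    ∃ V : Submodule ℝ (PMSol n → ℝ), IsPermInvariant V ∧ Module.finrank ℝ V ≤ d ^ 2 ∧
      ∀ U : Finset (Fin n), Odd U.card →
        ∃ (s : ℕ) (g : Fin s → (PMSol n → ℝ)), (∀ j, g j ∈ V) ∧
          ∀ M : PMSol n, pmSlack U M.1 = ∑ j, (g j M) ^ 2 := by
  classical
  obtain ⟨hA, hB, hslack, hequi⟩ := h
  -- Step 1: orthogonalise `ρ`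
  obtain ⟨R, hRpd, horth⟩ := exists_posDef_orthogonalizer ρ
  have hRdet : IsUnit R.det := isUnit_iff_ne_zero.2 hRpd.det_pos.ne'
  have hRsymm : Rᵀ = R := by
    have h := hRpd.1.eq
    rwa [conjTranspose_eq_transpose_of_trivial] at h
  have hRinv_symm : R⁻¹ᵀ = R⁻¹ := by rw [transpose_nonsing_inv, hRsymm]
  set ρ' : Equiv.Perm (Fin n) → Matrix (Fin d) (Fin d) ℝ :=
    fun σ => R * (ρ σ : Matrix (Fin d) (Fin d) ℝ) * R⁻¹ with hρ'
  have horth' : ∀ σ, (ρ' σ)ᵀ * ρ' σ = 1 := horth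
  have horth'' : ∀ σ, ρ' σ * (ρ' σ)ᵀ = 1 := fun σ => mul_eq_one_comm.1 (horth' σ)
  -- Step 2: conjugated factors `A' = R A R`, `B' = R⁻¹ B R⁻¹`
  set A' : Finset (Sym2 (Fin n)) → Matrix (Fin d) (Fin d) ℝ := fun M => R * A M * R with hA'
  set B' : Finset (Fin n) → Matrix (Fin d) (Fin d) ℝ := fun U => R⁻¹ * B U * R⁻¹ with hB'
  have hA'psd : ∀ M, IsPMOn univ M → (A' M).PosSemidef := fun M hM => by
    have := (hA M hM).mul_mul_conjTranspose_same R
    rwa [conjTranspose_eq_transpose_of_trivial, hRsymm] at this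
  have hB'psd : ∀ U, Odd U.card → (B' U).PosSemidef := fun U hU => by
    have := (hB U hU).mul_mul_conjTranspose_same R⁻¹
    rwa [conjTranspose_eq_transpose_of_trivial, hRinv_symm] at this
  have hslack' : ∀ U M, Odd U.card → IsPMOn univ M → pmSlack U M = (A' M * B' U).trace := by
    intro U M hU hM
    rw [hslack U M hU hM]
    show (A M * B U).trace = (R * A M * R * (R⁻¹ * B U * R⁻¹)).trace
    calc (A M * B U).trace = (R⁻¹ * R * (A M * B U)).trace := by
          rw [nonsing_inv_mul R hRdet, Matrix.one_mul]
      _ = (R * (A M * B U) * R⁻¹).trace := (trace_mul_cycle _ _ _).symm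
      _ = (R * A M * R * (R⁻¹ * B U * R⁻¹)).trace := by
          rw [show R * A M * R * (R⁻¹ * B U * R⁻¹) = R * A M * (R * (R⁻¹ * (B U * R⁻¹))) by
            simp only [Matrix.mul_assoc], mul_nonsing_inv_cancel_left R (B U * R⁻¹) hRdet]
          simp only [Matrix.mul_assoc]
  have hequi' : ∀ σ M, IsPMOn univ M → A' (permEdges σ M) = ρ' σ * A' M * (ρ' σ)ᵀ := by
    intro σ M hM
    show R * A (permEdges σ M) * R =
      R * (ρ σ : Matrix (Fin d) (Fin d) ℝ) * R⁻¹ * (R * A M * R) * (R * (ρ σ : Matrix (Fin d) (Fin d) ℝ) * R⁻¹)ᵀ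
    rw [hequi σ M hM, transpose_mul, transpose_mul, hRinv_symm, hRsymm]
    calc R * ((ρ σ : Matrix (Fin d) (Fin d) ℝ) * A M * (ρ σ : Matrix (Fin d) (Fin d) ℝ)ᵀ) * R
        = R * (ρ σ : Matrix (Fin d) (Fin d) ℝ) * (A M * ((ρ σ : Matrix (Fin d) (Fin d) ℝ)ᵀ * R)) := by
          simp only [Matrix.mul_assoc]
      _ = R * (ρ σ : Matrix (Fin d) (Fin d) ℝ) * (R⁻¹ * (R * A M * R) *
            (R⁻¹ * ((ρ σ : Matrix (Fin d) (Fin d) ℝ)ᵀ * R))) := by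
          rw [show R⁻¹ * (R * A M * R) * (R⁻¹ * ((ρ σ : Matrix (Fin d) (Fin d) ℝ)ᵀ * R))
              = R⁻¹ * (R * (A M * (R * (R⁻¹ * ((ρ σ : Matrix (Fin d) (Fin d) ℝ)ᵀ * R))))) by
              simp only [Matrix.mul_assoc],
            nonsing_inv_mul_cancel_left R _ hRdet, mul_nonsing_inv_cancel_left R _ hRdet]
      _ = R * (ρ σ : Matrix (Fin d) (Fin d) ℝ) * R⁻¹ * (R * A M * R) *
            (R⁻¹ * ((ρ σ : Matrix (Fin d) (Fin d) ℝ)ᵀ * R)) := by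
          simp only [Matrix.mul_assoc]
  -- Step 3: the equivariant psd square root `C(M) = A'(M)^{1/2}`
  set C : Finset (Sym2 (Fin n)) → Matrix (Fin d) (Fin d) ℝ := fun M => CFC.sqrt (A' M) with hC
  have hCpsd : ∀ M, (C M).PosSemidef := fun M => (CFC.sqrt_nonneg (A' M)).posSemidef
  have hCC : ∀ M, IsPMOn univ M → C M * C M = A' M := fun M hM =>
    CFC.sqrt_mul_sqrt_self (A' M) (hA'psd M hM).nonneg
  have hCsymm : ∀ M, (C M)ᵀ = C M := fun M => by
    have h := (hCpsd M).1.eq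
    rwa [conjTranspose_eq_transpose_of_trivial] at h
  have hCequi : ∀ σ M, IsPMOn univ M → C (permEdges σ M) = ρ' σ * C M * (ρ' σ)ᵀ := by
    intro σ M hM
    have hD : (ρ' σ * C M * (ρ' σ)ᵀ).PosSemidef := by
      have := (hCpsd M).mul_mul_conjTranspose_same (ρ' σ)
      rwa [conjTranspose_eq_transpose_of_trivial] at this
    refine CFC.sqrt_unique ?_ hD.nonneg
    rw [hequi' σ M hM, ← hCC M hM]
    calc ρ' σ * C M * (ρ' σ)ᵀ * (ρ' σ * C M * (ρ' σ)ᵀ)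
        = ρ' σ * C M * ((ρ' σ)ᵀ * ρ' σ) * C M * (ρ' σ)ᵀ := by simp only [Matrix.mul_assoc]
      _ = ρ' σ * (C M * C M) * (ρ' σ)ᵀ := by rw [horth' σ, Matrix.mul_one]; simp only [Matrix.mul_assoc]
  -- Step 4: `V` = span of the entry functions of `C`
  let e : Fin d × Fin d → (PMSol n → ℝ) := fun p M => C M.1 p.1 p.2
  set V : Submodule ℝ (PMSol n → ℝ) := Submodule.span ℝ (Set.range e) with hV
  have he : ∀ p, e p ∈ V := fun p => Submodule.subset_span ⟨p, rfl⟩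
  refine ⟨V, ?_, ?_, ?_⟩
  · -- invariance
    intro σ f hf
    -- the translation operator is linear; check it on generators
    let L : (PMSol n → ℝ) →ₗ[ℝ] (PMSol n → ℝ) := LinearMap.funLeft ℝ ℝ fun M : PMSol n => σ⁻¹ • M
    have hL : ∀ f : PMSol n → ℝ, L f = fun M => f (σ⁻¹ • M) := fun f => rfl
    suffices hgen : ∀ p, L (e p) ∈ V by
      rw [← hL]
      refine Submodule.span_induction (p := fun f _ => L f ∈ V) (fun f hf' => ?_) ?_ ?_ ?_ hf
      · obtain ⟨p, rfl⟩ := hf'; exact hgen p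
      · rw [map_zero]; exact V.zero_mem
      · intro f g _ _ hf hg; rw [map_add]; exact V.add_mem hf hg
      · intro a f _ hf; rw [map_smul]; exact V.smul_mem a hf
    intro p
    have hexp : L (e p) = ∑ a, ∑ b, (ρ' σ⁻¹ p.1 a * ρ' σ⁻¹ p.2 b) • e (a, b) := by
      funext M
      rw [hL]
      show C (σ⁻¹ • M).1 p.1 p.2 = (∑ a, ∑ b, (ρ' σ⁻¹ p.1 a * ρ' σ⁻¹ p.2 b) • e (a, b)) M
      rw [PMSol.smul_val, show M.1.image (Sym2.map ⇑σ⁻¹) = permEdges σ⁻¹ M.1 from rfl,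
        hCequi σ⁻¹ M.1 M.2, conj_apply]
      simp only [Finset.sum_apply, Pi.smul_apply, smul_eq_mul, e]
    rw [hexp]
    exact Submodule.sum_mem _ fun a _ => Submodule.sum_mem _ fun b _ => Submodule.smul_mem _ _ (he _)
  · -- dimension
    calc Module.finrank ℝ V = (Set.range e).finrank ℝ := rfl
      _ ≤ Fintype.card (Fin d × Fin d) := finrank_range_le_card e
      _ = d ^ 2 := by simp [sq]
  · -- sums of squares
    intro U hU
    obtain ⟨Lmat, hL⟩ := exists_eq_conjTranspose_mul_self (hB'psd U hU)
    rw [conjTranspose_eq_transpose_of_trivial] at hL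
    -- `g (a,b) M = (L C(M))_{ab}`
    let g' : Fin d × Fin d → (PMSol n → ℝ) := fun p M => (Lmat * C M.1) p.1 p.2
    have hg'V : ∀ p, g' p ∈ V := by
      intro p
      have hexp : g' p = ∑ k, Lmat p.1 k • e (k, p.2) := by
        funext M
        simp only [g', e, mul_apply, Finset.sum_apply, Pi.smul_apply, smul_eq_mul]
      rw [hexp]
      exact Submodule.sum_mem _ fun k _ => Submodule.smul_mem _ _ (he _)
    let σe := Fintype.equivFin (Fin d × Fin d)
    refine ⟨Fintype.card (Fin d × Fin d), fun j => g' (σe.symm j), fun j => hg'V _, fun M => ?_⟩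
    rw [hslack' U M.1 hU M.2, ← hCC M.1 M.2, hL]
    calc (C M.1 * C M.1 * (Lmatᵀ * Lmat)).trace
        = (C M.1 * C M.1 * Lmatᵀ * Lmat).trace := by rw [← Matrix.mul_assoc]
      _ = (Lmat * (C M.1 * C M.1) * Lmatᵀ).trace := trace_mul_cycle (C M.1 * C M.1) Lmatᵀ Lmat
      _ = ((Lmat * C M.1) * (Lmat * C M.1)ᵀ).trace := by
          rw [transpose_mul, hCsymm]; simp only [Matrix.mul_assoc]
      _ = ∑ a, ∑ b, (Lmat * C M.1) a b ^ 2 := trace_mul_transpose_self_eq_sum_sq _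
      _ = ∑ p : Fin d × Fin d, g' p M ^ 2 := (Fintype.sum_prod_type' fun a b => g' (a, b) M ^ 2).symm
      _ = ∑ j, g' (σe.symm j) M ^ 2 := (Equiv.sum_comp σe.symm (fun p => g' p M ^ 2)).symm

end Structure

end Literature.Combinatorics.Optimization

end
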